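import Literature.NumberTheory.QuadraticFields.KroneckerSplitting
import Literature.NumberTheory.QuadraticFields.FundamentalDiscriminant
import Literature.NumberTheory.QuadraticFields.JacobiCharacter
import Literature.NumberTheory.NumberFields.PrimesOverRegroup
import Literature.NumberTheory.LFunctions.DedekindZetaProofs
import Mathlib.NumberTheory.EulerProduct.DirichletLSeries
import Mathlib.NumberTheory.LSeries.DirichletContinuation
import HarnessLib

/-!
# The Dedekind zeta function of a quadratic field: `ζ_K(s) = ζ(s) · L(s, χ_{d_K})`,
# and Dirichlet's class number formula for quadratic fields (odd discriminant)

Topic `NumberTheory/QuadraticFields`, namespace `Literature.NumberTheory.QuadraticFields.Quadratic`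
(continuing `KroneckerSplitting.lean`). Everything here is PROVED (theorems only, no named facts).

Let `K` be a quadratic field (`[K : ℚ] = 2`) with **odd** discriminant `D = d_K` (so
`D ≡ 1 (mod 4)` is square-free, `FundamentalDiscriminant.lean`), `q = |D|`, and let
`χ = χ_D = (· / q)` be the Jacobi character modulo `q` (`jacobiChar q`, `JacobiCharacter.lean`),
which is the Kronecker symbol `(D / ·)` (Cox, Lemma 1.14). We prove:

* **the local Euler factors** `finprod_primesOver_eq`: for every rational prime `p` and every
  completely multiplicative `f : ℕ →* ℂ`,
  `∏_{𝔭 ∣ p} (1 − f(N𝔭))⁻¹ = (1 − f(p))⁻¹ (1 − χ(p) f(p))⁻¹`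
  — the decomposition law (Cox, *Primes of the form x² + ny²*, Prop. 5.16, PDF p. 119 of the held
  copy: `p𝓞_K = 𝔭²`, `𝔭𝔭'` or prime according as `(d_K/p) = 0, 1, −1`) read through
  Dedekind–Kummer for `𝓞 K = ℤ[ω]` (`NumberField.Ideal.primesOverSpanEquivMonicFactorsMod`:
  inertia degrees are the degrees of the monic irreducible factors of `X² − tX − m (mod p)`,
  `ω² = m + tω`, `d_K = t² + 4m`);
* **`dedekindZeta_eq_riemannZeta_mul_LSeries`**: `ζ_K(s) = ζ(s) · L(s, χ_D)` for `Re s > 1`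
  (Montgomery–Vaughan, *Multiplicative Number Theory I*, §10.1 Exercise 26; the method of
  Neukirch, *Algebraic Number Theory*, VII (5.12): "the proof hinges on the law of decomposition of
  prime numbers `p` in the field `K`" — the Euler product of `ζ_K`
  (`Literature.NumberTheory.LFunctions.hasProd_dedekindEulerFactor_holds`, Neukirch VII (5.2))
  regrouped by rational primes (`NumberFields/PrimesOverRegroup.lean`) against Mathlib's Euler
  products `riemannZeta_eulerProduct_hasProd`, `DirichletCharacter.LSeries_eulerProduct_hasProd`);
* **`LFunction_jacobiChar_one_eq_dedekindZeta_residue`** — Dirichlet's class number formula for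
  `K`: `L(1, χ_D) = 2^{r₁} (2π)^{r₂} h R / (w |d_K|^{1/2})`, the residue of `ζ_K` at `1`
  (Neukirch VII §5, after (5.11): "commonly known as the analytic class number formula"; Mathlib
  `NumberField.tendsto_sub_one_mul_dedekindZeta_nhdsGT` together with `(s − 1)ζ(s) → 1`), and its
  two signatures `LFunction_jacobiChar_one_eq_of_discr_neg` (`= 2πh/(w√|D|)`, with `r₁ = 0`,
  `r₂ = 1`, `R = 1`) and `LFunction_jacobiChar_one_eq_of_discr_pos` (`= 4hR/(w√D)`, `r₁ = 2`,
  `r₂ = 0`).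

Mathlib has the analytic class number formula for the residue of `ζ_K` and the Euler products of
`ζ` and `L(·, χ)`, but neither quadratic fields nor `ζ_K = ζ L` (searched `dedekindZeta` with
`riemannZeta`/`LFunction`; the tree's `LFunctions/DedekindZeta*.lean` treat `K = ℚ` only).

## References

* [Cox2013] D. A. Cox, *Primes of the form x² + ny²*, 2nd ed. (2013), §5.B Prop. 5.16 (PDF p. 119),
  §1.C Lemma 1.14.
* [NeukirchANT1999] J. Neukirch, *Algebraic Number Theory* (1999), Ch. VII §5, (5.2), (5.11) and the
  analytic class number formula following it, (5.12) (PDF pp. 410–411 of the held copy).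
* [MontgomeryVaughan2007] H. L. Montgomery, R. C. Vaughan, *Multiplicative Number Theory I* (2007),
  §10.1, Exercise 26 (`ζ_K(s) = ζ(s) L(s, χ_d)` for quadratic `K`).
-/

noncomputable section

open Module NumberField Polynomial Ideal UniqueFactorizationMonoid IsDedekindDomain
open scoped NumberTheorySymbols

namespace Literature.NumberTheory.QuadraticFields.Quadratic

/-! ### Monic irreducible factors of a quadratic over a field, with their degrees -/

section Field

variable {F : Type*} [Field F] [DecidableEq F]

/-- The monic irreducible factors of `(X − a)(X − c)` are `X − a` and `X − c`. [folklore] -/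
theorem toFinset_normalizedFactors_mul (a c : F) :
    (normalizedFactors ((X - C a) * (X - C c))).toFinset = {X - C a, X - C c} := by
  rw [normalizedFactors_mul (X_sub_C_ne_zero a) (X_sub_C_ne_zero c),
    normalizedFactors_irreducible (irreducible_X_sub_C a),
    normalizedFactors_irreducible (irreducible_X_sub_C c),
    (monic_X_sub_C a).normalize_eq_self, (monic_X_sub_C c).normalize_eq_self,
    Multiset.toFinset_add, Multiset.toFinset_singleton, Multiset.toFinset_singleton]
  rfl

/-- The only monic irreducible factor of `(X − a)²` is `X − a`. [folklore] -/
theorem toFinset_normalizedFactors_sq (a : F) :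
    (normalizedFactors ((X - C a) ^ 2)).toFinset = {X - C a} := by
  rw [normalizedFactors_pow, Multiset.toFinset_nsmul _ _ two_ne_zero,
    normalizedFactors_irreducible (irreducible_X_sub_C a), (monic_X_sub_C a).normalize_eq_self,
    Multiset.toFinset_singleton]

/-- The only monic irreducible factor of a monic irreducible `f` is `f`. [folklore] -/
theorem toFinset_normalizedFactors_of_irreducible {f : F[X]} (hf : Irreducible f) (hm : f.Monic) :
    (normalizedFactors f).toFinset = {f} := by
  rw [normalizedFactors_irreducible hf, hm.normalize_eq_self, Multiset.toFinset_singleton]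

/-- Every monic irreducible factor of `X² − uX − v` has degree `1` when `u² + 4v` is a square and
`2 ≠ 0`. [folklore] -/
theorem natDegree_eq_one_of_mem_of_sq_eq [NeZero (2 : F)] {u v s : F} (hs : s ^ 2 = u ^ 2 + 4 * v)
    {Q : F[X]} (hQ : Q ∈ (normalizedFactors (X ^ 2 - C u * X - C v : F[X])).toFinset) :
    Q.natDegree = 1 := by
  rw [X_sq_sub_eq_mul_of_sq_eq hs] at hQ
  by_cases hac : (u + s) / 2 = (u - s) / 2
  · rw [hac, ← sq, toFinset_normalizedFactors_sq, Finset.mem_singleton] at hQ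
    rw [hQ, natDegree_X_sub_C]
  · rw [toFinset_normalizedFactors_mul, Finset.mem_insert, Finset.mem_singleton] at hQ
    rcases hQ with rfl | rfl <;> exact natDegree_X_sub_C _

/-- The unique monic irreducible factor of `X² − uX − v` has degree `2` when `u² + 4v` is not a
square. [folklore] -/
theorem natDegree_eq_two_of_mem_of_not_isSquare {u v : F} (h : ¬ IsSquare (u ^ 2 + 4 * v))
    {Q : F[X]} (hQ : Q ∈ (normalizedFactors (X ^ 2 - C u * X - C v : F[X])).toFinset) :
    Q.natDegree = 2 := by
  rw [toFinset_normalizedFactors_of_irreducible (irreducible_X_sq_sub_of_not_isSquare h)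
    (by monicity!), Finset.mem_singleton] at hQ
  rw [hQ, natDegree_X_sq_sub]

/-- Over `𝔽₂`: every monic irreducible factor of `X² − X − v` has degree `1` if `v = 0`
(`X(X − 1)`). [folklore] -/
theorem natDegree_eq_one_of_mem_one_zero {Q : F[X]}
    (hQ : Q ∈ (normalizedFactors (X ^ 2 - C 1 * X - C 0 : F[X])).toFinset) : Q.natDegree = 1 := by
  rw [show (X ^ 2 - C 1 * X - C 0 : F[X]) = (X - C 0) * (X - C 1) from
    X_sq_sub_eq_mul (by ring) (by ring), toFinset_normalizedFactors_mul,
    Finset.mem_insert, Finset.mem_singleton] at hQ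
  rcases hQ with rfl | rfl <;> exact natDegree_X_sub_C _

/-- Over `𝔽₂`: the unique monic irreducible factor of `X² − X − 1 = X² + X + 1` has degree `2`.
[folklore] -/
theorem natDegree_eq_two_of_mem_one_one_zmod_two {Q : (ZMod 2)[X]}
    (hQ : Q ∈ (normalizedFactors (X ^ 2 - C 1 * X - C 1 : (ZMod 2)[X])).toFinset) :
    Q.natDegree = 2 := by
  have hirr : Irreducible (X ^ 2 - C 1 * X - C 1 : (ZMod 2)[X]) := by
    refine irreducible_of_degree_le_three_of_not_isRoot ?_ fun r hr => ?_
    · rw [natDegree_X_sq_sub]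
      decide
    · simp only [IsRoot.def, eval_sub, eval_pow, eval_X, eval_mul, eval_C] at hr
      revert r
      decide
  rw [toFinset_normalizedFactors_of_irreducible hirr (by monicity!), Finset.mem_singleton] at hQ
  rw [hQ, natDegree_X_sq_sub]

end Field

/-! ### Inertia degrees of the primes above `p` in a quadratic field -/

section Local

variable {K : Type*} [Field K] [NumberField K]

/-- Dedekind–Kummer for `𝓞 K = ℤ[ω]`: the monic factors of `minpoly ω` mod `p` are those of
`X² − tX − m`. [folklore] -/
theorem monicFactorsMod_basis_one (b : Basis (Fin 2) ℤ (𝓞 K)) (hb : b 0 = 1) (p : ℕ)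
    [Fact p.Prime] :
    RingOfIntegers.monicFactorsMod (b 1) p =
      (normalizedFactors (X ^ 2 - C ((b.repr (b 1 * b 1) 1 : ℤ) : ZMod p) * X
        - C ((b.repr (b 1 * b 1) 0 : ℤ) : ZMod p))).toFinset := by
  simp only [RingOfIntegers.monicFactorsMod, minpoly_basis_one b hb, Polynomial.map_sub,
    Polynomial.map_mul, Polynomial.map_pow, map_X, map_C]
  simp only [eq_intCast]

/-- **Inertia degrees from Dedekind–Kummer.** If every monic irreducible factor of
`X² − tX − m (mod p)` has degree `d`, then every prime of `𝓞 K` above `p` has absolute norm `p ^ d`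
(`(1, ω)` an integral basis with `ω² = m + tω`). [folklore] -/
theorem absNorm_eq_pow_of_forall_natDegree_eq (b : Basis (Fin 2) ℤ (𝓞 K)) (hb : b 0 = 1) {p : ℕ}
    [hp : Fact p.Prime] {d : ℕ}
    (hd : ∀ Q ∈ (normalizedFactors (X ^ 2 - C ((b.repr (b 1 * b 1) 1 : ℤ) : ZMod p) * X
        - C ((b.repr (b 1 * b 1) 0 : ℤ) : ZMod p))).toFinset, Q.natDegree = d)
    {P : Ideal (𝓞 K)} (hP : P ∈ primesOver (span {(p : ℤ)}) (𝓞 K)) :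
    absNorm P = p ^ d := by
  have hexp : ¬ p ∣ RingOfIntegers.exponent (b 1) := by
    rw [exponent_basis_one b hb, Nat.dvd_one]
    exact hp.out.ne_one
  set e := NumberField.Ideal.primesOverSpanEquivMonicFactorsMod (K := K) hexp with he
  set Q := e ⟨P, hP⟩ with hQ
  have hQmem : (Q : (ZMod p)[X]) ∈ RingOfIntegers.monicFactorsMod (b 1) p := Q.2
  have hdeg := NumberField.Ideal.inertiaDeg_primesOverSpanEquivMonicFactorsMod_symm_apply' hexp hQmem
  have hPQ : ((e.symm ⟨Q, hQmem⟩ : primesOver (span {(p : ℤ)}) (𝓞 K)) : Ideal (𝓞 K)) = P := by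
    rw [Subtype.coe_eta, hQ, Equiv.symm_apply_apply]
  rw [hPQ] at hdeg
  have hQmem' : (Q : (ZMod p)[X]) ∈ (normalizedFactors (X ^ 2 - C ((b.repr (b 1 * b 1) 1 : ℤ) : ZMod p) * X
      - C ((b.repr (b 1 * b 1) 0 : ℤ) : ZMod p))).toFinset := by
    rw [← monicFactorsMod_basis_one b hb p]
    exact Q.2
  haveI := hP.1
  haveI := hP.2
  rw [← Ideal.pow_inertiaDeg p P, hdeg, hd _ hQmem']

/-! ### Finite products over sets with one or two elements -/

/-- A `finprod` over a one-element set on which the function is constant. [folklore] -/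
theorem finprod_mem_eq_of_ncard_eq_one {α M : Type*} [CommMonoid M] {s : Set α} {g : α → M} {c : M}
    (hs : s.ncard = 1) (hg : ∀ x ∈ s, g x = c) : ∏ᶠ x ∈ s, g x = c := by
  obtain ⟨a, rfl⟩ := Set.ncard_eq_one.mp hs
  rw [finprod_mem_singleton, hg a rfl]

/-- A `finprod` over a two-element set on which the function is constant. [folklore] -/
theorem finprod_mem_eq_of_ncard_eq_two {α M : Type*} [CommMonoid M] {s : Set α} {g : α → M} {c : M}
    (hs : s.ncard = 2) (hg : ∀ x ∈ s, g x = c) : ∏ᶠ x ∈ s, g x = c * c := by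
  obtain ⟨a, b, hab, rfl⟩ := Set.ncard_eq_two.mp hs
  rw [finprod_mem_pair hab, hg a (by simp), hg b (by simp)]

/-! ### The local Euler factors of a quadratic field with odd discriminant -/

/-- `|d_K| ≠ 0`, as an instance for `jacobiChar |d_K|`. [folklore] -/
theorem neZero_natAbs_discr : NeZero (NumberField.discr K).natAbs :=
  ⟨Int.natAbs_ne_zero.mpr (NumberField.discr_ne_zero K)⟩

attribute [instance] neZero_natAbs_discr

/-- An odd discriminant is `≡ 1 (mod 4)` (Stickelberger). [folklore] -/
theorem discr_emod_four_eq_one (h2 : finrank ℚ K = 2) (hodd : Odd (NumberField.discr K)) :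
    NumberField.discr K % 4 = 1 := by
  rcases discr_emod_four (K := K) h2 with h | h
  · exfalso
    rw [Int.odd_iff] at hodd
    omega
  · exact h

/-- The algebra of the inert factor: `(1 − x²)⁻¹ = (1 − x)⁻¹ (1 + x)⁻¹`. [folklore] -/
theorem inv_one_sub_sq (x : ℂ) : (1 - x ^ 2)⁻¹ = (1 - x)⁻¹ * (1 - (-1) * x)⁻¹ := by
  rw [← mul_inv, show (1 - x) * (1 - (-1) * x) = 1 - x ^ 2 by ring]

/-- **The local Euler factors of a quadratic field with odd discriminant.** Let `[K : ℚ] = 2` with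
`d_K` odd, `χ = (· / |d_K|)` (`= (d_K / ·)`, the Kronecker symbol), `p` a prime and `f : ℕ →* ℂ`
completely multiplicative. Then
`∏_{𝔭 ∣ p} (1 − f(N𝔭))⁻¹ = (1 − f(p))⁻¹ · (1 − χ(p) f(p))⁻¹`,
i.e. the decomposition law (Cox, Prop. 5.16): two primes of norm `p` if
`χ(p) = 1`, one prime of norm `p²` if `χ(p) = −1`, one prime of norm `p` if `p ∣ d_K`, obtained from
Dedekind–Kummer for `𝓞 K = ℤ[ω]` (`ω² = m + tω`, `d_K = t² + 4m`; inertia degrees = degrees of the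
monic irreducible factors of `X² − tX − m (mod p)`). [cite: Cox2013, §5.B Prop. 5.16 (PDF p. 119)] -/
theorem finprod_primesOver_eq (h2 : finrank ℚ K = 2) (hodd : Odd (NumberField.discr K))
    (f : ℕ →* ℂ) {p : ℕ} (hp : p.Prime) :
    ∏ᶠ P ∈ primesOver (span {(p : ℤ)}) (𝓞 K), (1 - f (absNorm P))⁻¹ =
      (1 - f p)⁻¹ * (1 - jacobiChar (NumberField.discr K).natAbs p * f p)⁻¹ := by
  haveI := Fact.mk hp
  obtain ⟨b, hb⟩ := exists_basis_zero_eq_one h2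
  have hD := discr_eq_sq_add_four_mul b hb
  have hD4 := discr_emod_four_eq_one h2 hodd
  set D := NumberField.discr K with hDdef
  generalize ht : b.repr (b 1 * b 1) 1 = t at hD
  generalize hm : b.repr (b 1 * b 1) 0 = m at hD
  -- the factors of `X² − tX − m (mod p)` control norms (`hnorm`) and the number of primes (`hcount`)
  have hnorm : ∀ {d : ℕ}, (∀ Q ∈ (normalizedFactors (X ^ 2 - C ((t : ℤ) : ZMod p) * X
      - C ((m : ℤ) : ZMod p))).toFinset, Q.natDegree = d) →
      ∀ P ∈ primesOver (span {(p : ℤ)}) (𝓞 K), absNorm P = p ^ d := by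
    intro d hd P hP
    refine absNorm_eq_pow_of_forall_natDegree_eq b hb ?_ hP
    rw [ht, hm]
    exact hd
  have hcount : (primesOver (span {(p : ℤ)}) (𝓞 K)).ncard = (normalizedFactors (X ^ 2
      - C ((t : ℤ) : ZMod p) * X - C ((m : ℤ) : ZMod p))).toFinset.card := by
    rw [ncard_primesOver_eq_card_toFinset b hb, ht, hm]
  have hχ : jacobiChar D.natAbs p = (J((p : ℤ) | D.natAbs) : ℂ) := jacobiChar_natCast p
  rcases eq_or_ne p 2 with rfl | hp2
  · -- `p = 2`: `t` is odd since `d_K = t² + 4m` is odd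
    have htodd : Odd t := by
      have h := hodd
      rw [hD, Int.odd_add] at h
      have h4 : Even (4 * m) := ⟨2 * m, by ring⟩
      exact (Int.odd_pow.mp (h.mpr h4)).resolve_right two_ne_zero
    obtain ⟨k, rfl⟩ := htodd
    have h1 : (((2 * k + 1 : ℤ)) : ZMod 2) = 1 := by
      rw [Int.cast_add, Int.cast_mul, Int.cast_ofNat, show (2 : ZMod 2) = 0 from rfl, zero_mul,
        zero_add, Int.cast_one]
    obtain ⟨i, hi⟩ := Int.even_mul_succ_self k
    rcases Int.even_or_odd' m with ⟨j, rfl | rfl⟩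
    · -- `m` even: `X(X − 1)`, `2` splits, `d_K ≡ 1 (mod 8)`, `χ(2) = 1`
      have h0 : (((2 * j : ℤ)) : ZMod 2) = 0 := by
        rw [Int.cast_mul, Int.cast_ofNat, show (2 : ZMod 2) = 0 from rfl, zero_mul]
      rw [h1, h0] at hnorm hcount
      have hN := hnorm (d := 1) fun Q hQ => natDegree_eq_one_of_mem_one_zero hQ
      rw [card_toFinset_normalizedFactors_X_sq_sub_one_zero] at hcount
      have hD8 : D % 8 = 1 := by
        rw [hD]
        have : (2 * k + 1) ^ 2 + 4 * (2 * j) = 8 * (i + j) + 1 := by linear_combination 4 * hi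
        omega
      rw [finprod_mem_eq_of_ncard_eq_two hcount fun P hP => by rw [hN P hP, pow_one], hχ,
        Nat.cast_ofNat, (jacobiSym_two_natAbs_eq_one_iff hD4).mpr hD8, Int.cast_one, one_mul]
    · -- `m` odd: `X² + X + 1`, `2` is inert, `d_K ≡ 5 (mod 8)`, `χ(2) = −1`
      have h1' : (((2 * j + 1 : ℤ)) : ZMod 2) = 1 := by
        rw [Int.cast_add, Int.cast_mul, Int.cast_ofNat, show (2 : ZMod 2) = 0 from rfl, zero_mul,
          zero_add, Int.cast_one]
      rw [h1, h1'] at hnorm hcount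
      have hN := hnorm (d := 2) fun Q hQ => natDegree_eq_two_of_mem_one_one_zmod_two hQ
      rw [card_toFinset_normalizedFactors_X_sq_sub_one_one_zmod_two] at hcount
      have hD8 : D % 8 = 5 := by
        rw [hD]
        have : (2 * k + 1) ^ 2 + 4 * (2 * j + 1) = 8 * (i + j) + 5 := by linear_combination 4 * hi
        omega
      rw [finprod_mem_eq_of_ncard_eq_one hcount fun P hP => by rw [hN P hP], hχ, Nat.cast_ofNat,
        (jacobiSym_two_natAbs_eq_neg_one_iff hD4).mpr hD8, map_pow, inv_one_sub_sq]
      push_cast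
      ring
  · -- `p` odd
    haveI : NeZero (2 : ZMod p) := ⟨two_ne_zero_zmod hp2⟩
    have hpodd : Odd p := hp.odd_of_ne_two hp2
    have hcast : (((t ^ 2 + 4 * m : ℤ)) : ZMod p) = (t : ZMod p) ^ 2 + 4 * (m : ZMod p) := by
      push_cast
      ring
    have hJ : (J((p : ℤ) | D.natAbs) : ℂ) = legendreSym p D := by
      rw [jacobiSym_natAbs_eq_of_emod_four_eq_one hD4 hpodd, jacobiSym.legendreSym.to_jacobiSym]
    rw [hχ, hJ]
    by_cases h0 : ((D : ℤ) : ZMod p) = 0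
    · -- ramified: `p ∣ d_K`, one prime of norm `p`, `χ(p) = 0`
      have hs : (0 : ZMod p) ^ 2 = (t : ZMod p) ^ 2 + 4 * (m : ZMod p) := by
        rw [← hcast, ← hD, h0]; ring
      have hN := hnorm (d := 1) fun Q hQ => natDegree_eq_one_of_mem_of_sq_eq hs hQ
      rw [card_toFinset_normalizedFactors_X_sq_sub_of_eq_zero (hcast ▸ hD ▸ h0)] at hcount
      rw [finprod_mem_eq_of_ncard_eq_one hcount fun P hP => by rw [hN P hP, pow_one],
        (legendreSym.eq_zero_iff p D).mpr h0, Int.cast_zero, zero_mul, sub_zero, inv_one, mul_one]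
    · by_cases hsq : IsSquare ((D : ℤ) : ZMod p)
      · -- split: two primes of norm `p`, `χ(p) = 1`
        obtain ⟨r, hr⟩ := hsq
        have hs : r ^ 2 = (t : ZMod p) ^ 2 + 4 * (m : ZMod p) := by rw [← hcast, ← hD, hr, sq]
        have hr0 : r ≠ 0 := by rintro rfl; exact h0 (by rw [hr, mul_zero])
        have hN := hnorm (d := 1) fun Q hQ => natDegree_eq_one_of_mem_of_sq_eq hs hQ
        rw [card_toFinset_normalizedFactors_X_sq_sub_of_sq_eq hs hr0] at hcount
        rw [finprod_mem_eq_of_ncard_eq_two hcount fun P hP => by rw [hN P hP, pow_one],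
          (legendreSym.eq_one_iff p h0).mpr ⟨r, hr⟩, Int.cast_one, one_mul]
      · -- inert: one prime of norm `p²`, `χ(p) = −1`
        have hns : ¬ IsSquare ((t : ZMod p) ^ 2 + 4 * (m : ZMod p)) := by rwa [← hcast, ← hD]
        have hN := hnorm (d := 2) fun Q hQ => natDegree_eq_two_of_mem_of_not_isSquare hns hQ
        rw [card_toFinset_normalizedFactors_X_sq_sub_of_not_isSquare hns] at hcount
        rw [finprod_mem_eq_of_ncard_eq_one hcount fun P hP => by rw [hN P hP],
          (legendreSym.eq_neg_one_iff p).mpr hsq, map_pow, inv_one_sub_sq, Int.cast_neg, Int.cast_one]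

end Local

/-! ### `ζ_K(s) = ζ(s) L(s, χ_{d_K})` -/

section Zeta

variable {K : Type*} [Field K] [NumberField K]

/-- **The Dedekind zeta function of a quadratic field with odd discriminant factors as
`ζ_K(s) = ζ(s) · L(s, χ_{d_K})`** for `Re s > 1`, `χ_{d_K} = (· / |d_K|)` the Kronecker symbol
(Montgomery–Vaughan §10.1 Ex. 26; Neukirch VII (5.12) for the method): the Euler product of `ζ_K`
(`Literature.NumberTheory.LFunctions.hasProd_dedekindEulerFactor_holds`, Neukirch VII (5.2)) regrouped
by rational primes (`HasProd.primesOver_regroup`), the local factors `finprod_primesOver_eq`, and the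
Euler products of `ζ` and `L(·, χ)` (Mathlib). [cite: MontgomeryVaughan2007, §10.1 Exercise 26] -/
theorem dedekindZeta_eq_riemannZeta_mul_LSeries (h2 : finrank ℚ K = 2)
    (hodd : Odd (NumberField.discr K)) {s : ℂ} (hs : 1 < s.re) :
    NumberField.dedekindZeta K s =
      riemannZeta s * LSeries (fun n => jacobiChar (NumberField.discr K).natAbs n) s := by
  have hs0 : s ≠ 0 := fun h => by rw [h, Complex.zero_re] at hs; linarith
  set χ := jacobiChar (NumberField.discr K).natAbs with hχ
  set f : ℕ →* ℂ := (riemannZetaSummandHom hs0 : ℕ →* ℂ) with hfdef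
  have hf : ∀ n : ℕ, f n = (n : ℂ) ^ (-s) := fun n => rfl
  set G : Ideal (𝓞 K) → ℂ := fun P => (1 - f (absNorm P))⁻¹ with hG
  -- the Euler product of `ζ_K`, regrouped by rational primes
  have h1 : HasProd (fun v : HeightOneSpectrum (𝓞 K) => G v.asIdeal) (NumberField.dedekindZeta K s) :=
    Literature.NumberTheory.LFunctions.hasProd_dedekindEulerFactor_holds K hs
  have h2' := Literature.NumberTheory.NumberFields.HasProd.primesOver_regroup h1
  have h3 : (fun p : Nat.Primes => ∏ᶠ P ∈ primesOver (span {((p : ℕ) : ℤ)}) (𝓞 K), G P) =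
      fun p : Nat.Primes => (1 - ((p : ℕ) : ℂ) ^ (-s))⁻¹ *
        (1 - χ ((p : ℕ) : ZMod (NumberField.discr K).natAbs) * ((p : ℕ) : ℂ) ^ (-s))⁻¹ := by
    funext p
    rw [hG]
    dsimp only
    rw [finprod_primesOver_eq h2 hodd f p.2, hf]
  rw [h3] at h2'
  -- the Euler products of `ζ` and `L(·, χ)`
  have h4 := (riemannZeta_eulerProduct_hasProd hs).mul
    (DirichletCharacter.LSeries_eulerProduct_hasProd χ hs)
  exact h2'.unique h4

end Zeta

/-! ### Dirichlet's class number formula for quadratic fields with odd discriminant -/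

section ClassNumberFormula

open Filter Topology NumberField.InfinitePlace NumberField.Units

variable {K : Type*} [Field K] [NumberField K]

/-- For a quadratic field with odd discriminant, `χ_{d_K} = (· / |d_K|)` is a non-trivial
character (`|d_K| > 2` is odd and square-free). [folklore] -/
theorem jacobiChar_natAbs_discr_ne_one (h2 : finrank ℚ K = 2) (hodd : Odd (NumberField.discr K)) :
    jacobiChar (NumberField.discr K).natAbs ≠ 1 := by
  rcases isFundamentalDiscriminant_discr (K := K) h2 with ⟨-, hsq, -⟩ | ⟨h4, -, -⟩
  · refine jacobiChar_ne_one (Int.natAbs_odd.mpr hodd) (Int.squarefree_natAbs.mpr hsq) fun h1 => ?_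
    have hgt : 2 < |NumberField.discr K| :=
      NumberField.abs_discr_gt_two (by rw [h2]; exact one_lt_two)
    have : (|NumberField.discr K| : ℤ) = ((NumberField.discr K).natAbs : ℤ) :=
      (Int.natCast_natAbs _).symm
    omega
  · exfalso
    rw [Int.odd_iff] at hodd
    omega

/-- The coercion `ℝ → ℂ` maps `𝓝[>] 1` into `𝓝[≠] 1`. [folklore] -/
theorem tendsto_ofReal_nhdsGT_one :
    Tendsto (fun s : ℝ => (s : ℂ)) (𝓝[>] 1) (𝓝[≠] 1) := by
  refine tendsto_nhdsWithin_iff.mpr ⟨?_, ?_⟩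
  · have h := (Complex.continuous_ofReal.tendsto (1 : ℝ)).mono_left (nhdsWithin_le_nhds (s := Set.Ioi 1))
    simpa using h
  · filter_upwards [self_mem_nhdsWithin] with s hs
    simp only [Set.mem_compl_iff, Set.mem_singleton_iff, Complex.ofReal_eq_one]
    exact ne_of_gt hs

/-- **Dirichlet's class number formula for a quadratic field with odd discriminant**
(Neukirch, *Algebraic Number Theory*, VII §5, the analytic class number formula after (5.11)):
`L(1, χ_{d_K}) = 2^{r₁} (2π)^{r₂} R_K h_K / (w_K √|d_K|)`, the residue of `ζ_K` at `s = 1`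
(Mathlib's analytic class number formula `NumberField.tendsto_sub_one_mul_dedekindZeta_nhdsGT`),
because `(s − 1) ζ_K(s) = ((s − 1)ζ(s)) · L(s, χ_{d_K}) → 1 · L(1, χ_{d_K})` as `s → 1⁺`.
[cite: NeukirchANT1999, Ch. VII §5 (5.11) (analytic class number formula)] -/
theorem LFunction_jacobiChar_one_eq_dedekindZeta_residue (h2 : finrank ℚ K = 2)
    (hodd : Odd (NumberField.discr K)) :
    DirichletCharacter.LFunction (jacobiChar (NumberField.discr K).natAbs) 1 =
      (NumberField.dedekindZeta_residue K : ℂ) := by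
  set χ := jacobiChar (NumberField.discr K).natAbs with hχdef
  have hχ : χ ≠ 1 := jacobiChar_natAbs_discr_ne_one h2 hodd
  have hK := NumberField.tendsto_sub_one_mul_dedekindZeta_nhdsGT K
  -- `((s − 1) ζ(s)) · L(s, χ) → 1 · L(1, χ)`
  have hζ : Tendsto (fun s : ℝ => ((s : ℂ) - 1) * riemannZeta s) (𝓝[>] 1) (𝓝 1) :=
    riemannZeta_residue_one.comp tendsto_ofReal_nhdsGT_one
  have hL : Tendsto (fun s : ℝ => χ.LFunction s) (𝓝[>] 1) (𝓝 (χ.LFunction 1)) := by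
    have hc : Continuous χ.LFunction := (DirichletCharacter.differentiable_LFunction hχ).continuous
    have h := (hc.tendsto (1 : ℂ)).comp
      ((Complex.continuous_ofReal.tendsto (1 : ℝ)).mono_left (nhdsWithin_le_nhds (s := Set.Ioi 1)))
    exact h
  have hG := hζ.mul hL
  rw [one_mul] at hG
  -- the two functions agree on `(1, ∞)`
  have heq : (fun s : ℝ => ((s : ℂ) - 1) * riemannZeta s * χ.LFunction s) =ᶠ[𝓝[>] 1]
      fun s : ℝ => ((s : ℂ) - 1) * NumberField.dedekindZeta K s := by
    filter_upwards [self_mem_nhdsWithin] with s hs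
    have hs' : 1 < (s : ℂ).re := by simpa using hs
    rw [dedekindZeta_eq_riemannZeta_mul_LSeries h2 hodd hs', DirichletCharacter.LFunction_eq_LSeries χ hs',
      mul_assoc]
  exact tendsto_nhds_unique (hG.congr' heq) hK

/-- The same with the residue written out:
`L(1, χ_{d_K}) = 2^{r₁} (2π)^{r₂} R_K h_K / (w_K √|d_K|)`.
[cite: NeukirchANT1999, Ch. VII §5 (5.11) (analytic class number formula)] -/
theorem LFunction_jacobiChar_one_eq (h2 : finrank ℚ K = 2) (hodd : Odd (NumberField.discr K)) :
    DirichletCharacter.LFunction (jacobiChar (NumberField.discr K).natAbs) 1 =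
      ((2 ^ nrRealPlaces K * (2 * Real.pi) ^ nrComplexPlaces K * regulator K * classNumber K /
        (torsionOrder K * Real.sqrt |(NumberField.discr K : ℝ)|) : ℝ) : ℂ) := by
  rw [LFunction_jacobiChar_one_eq_dedekindZeta_residue h2 hodd, NumberField.dedekindZeta_residue_def]

/-! #### The two signatures -/

/-- A quadratic field with `d_K < 0` has `r₁ = 0`, `r₂ = 1` (`sign d_K = (−1)^{r₂}`,
`r₁ + 2 r₂ = 2`). [folklore] -/
theorem nrRealPlaces_eq_zero_and_nrComplexPlaces_eq_one (h2 : finrank ℚ K = 2)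
    (hd : NumberField.discr K < 0) : nrRealPlaces K = 0 ∧ nrComplexPlaces K = 1 := by
  have hsign := NumberField.sign_discr K
  rw [Int.sign_eq_neg_one_of_neg hd] at hsign
  have hodd : Odd (nrComplexPlaces K) := by
    by_contra h
    rw [Nat.not_odd_iff_even] at h
    rw [h.neg_one_pow] at hsign
    norm_num at hsign
  have hrk := card_add_two_mul_card_eq_rank K
  rw [h2] at hrk
  obtain ⟨m, hm⟩ := hodd
  omega

/-- A quadratic field with `d_K > 0` has `r₁ = 2`, `r₂ = 0`. [folklore] -/
theorem nrRealPlaces_eq_two_and_nrComplexPlaces_eq_zero (h2 : finrank ℚ K = 2)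
    (hd : 0 < NumberField.discr K) : nrRealPlaces K = 2 ∧ nrComplexPlaces K = 0 := by
  have hsign := NumberField.sign_discr K
  rw [Int.sign_eq_one_of_pos hd] at hsign
  have heven : Even (nrComplexPlaces K) := by
    by_contra h
    rw [Nat.not_even_iff_odd] at h
    rw [h.neg_one_pow] at hsign
    norm_num at hsign
  have hrk := card_add_two_mul_card_eq_rank K
  rw [h2] at hrk
  obtain ⟨m, hm⟩ := heven
  omega

/-- An imaginary quadratic field has unit rank `0`, hence regulator `1`. [folklore] -/
theorem regulator_eq_one_of_discr_neg (h2 : finrank ℚ K = 2) (hd : NumberField.discr K < 0) :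
    regulator K = 1 := by
  have hr : rank K = 0 := by
    obtain ⟨h0, h1⟩ := nrRealPlaces_eq_zero_and_nrComplexPlaces_eq_one h2 hd
    rw [rank, card_eq_nrRealPlaces_add_nrComplexPlaces, h0, h1]
  classical
  have hcard : Fintype.card (InfinitePlace K) = 1 := by
    have h1 : 0 < Fintype.card (InfinitePlace K) := Fintype.card_pos
    rw [rank] at hr
    omega
  have hsub : ∀ a b : InfinitePlace K, a = b := Fintype.card_le_one_iff.mp hcard.le
  haveI : IsEmpty {w : InfinitePlace K // w ≠ dirichletUnitTheorem.w₀} := ⟨fun w => w.2 (hsub _ _)⟩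
  rw [regulator_eq_det', Matrix.det_isEmpty, abs_one]

/-- **Class number formula, imaginary quadratic case** (`d_K < 0` odd):
`L(1, χ_{d_K}) = 2π h_K / (w_K √|d_K|)`.
[cite: NeukirchANT1999, Ch. VII §5 (5.11) (analytic class number formula)] -/
theorem LFunction_jacobiChar_one_eq_of_discr_neg (h2 : finrank ℚ K = 2)
    (hodd : Odd (NumberField.discr K)) (hd : NumberField.discr K < 0) :
    DirichletCharacter.LFunction (jacobiChar (NumberField.discr K).natAbs) 1 =
      ((2 * Real.pi * classNumber K / (torsionOrder K * Real.sqrt |(NumberField.discr K : ℝ)|) : ℝ) : ℂ) := by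
  obtain ⟨h0, h1⟩ := nrRealPlaces_eq_zero_and_nrComplexPlaces_eq_one h2 hd
  rw [LFunction_jacobiChar_one_eq h2 hodd, h0, h1, regulator_eq_one_of_discr_neg h2 hd]
  norm_num

/-- **Class number formula, real quadratic case** (`d_K > 0` odd):
`L(1, χ_{d_K}) = 4 R_K h_K / (w_K √d_K)`.
[cite: NeukirchANT1999, Ch. VII §5 (5.11) (analytic class number formula)] -/
theorem LFunction_jacobiChar_one_eq_of_discr_pos (h2 : finrank ℚ K = 2)
    (hodd : Odd (NumberField.discr K)) (hd : 0 < NumberField.discr K) :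
    DirichletCharacter.LFunction (jacobiChar (NumberField.discr K).natAbs) 1 =
      ((4 * regulator K * classNumber K / (torsionOrder K * Real.sqrt (NumberField.discr K : ℝ)) : ℝ) : ℂ) := by
  obtain ⟨h0, h1⟩ := nrRealPlaces_eq_two_and_nrComplexPlaces_eq_zero h2 hd
  rw [LFunction_jacobiChar_one_eq h2 hodd, h0, h1,
    abs_of_pos (show (0 : ℝ) < NumberField.discr K by exact_mod_cast hd)]
  norm_num

end ClassNumberFormula

end Literature.NumberTheory.QuadraticFields.Quadratic
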